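import Summits.CriticalPhenomena.PercolationContinuityZ3.Theorems.Transplant.FKConnectivityAllQAntipodalRootFormSteps

/-!
# Connectivity correlation inequalities for `φ_{w,q}`, every `q > 0` — ROOT-FORM CALCULUS, file 61c: spine environments and the WORD
# THEOREM (the black-box theta law ★(Θ) for every spine word, in root form, from five facts about the base pair)

Support file (`--supports stmt-CriticalPhenomena-4575`), FK sub-lane `prim-bschramm-fk-2` (gen 28); builds on p205010 (kernel theorem,
internal audit signed; external expert review pending).  Standard axioms, no sorries.  Memo FROM-fk-2-g28-ROOT-FORM.md §4, FK-Q2 §37.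

`spine E W` is the environment `ℓ₁(ℓ₂(⋯ℓ_m(E)⋯))` of a word `W = [ℓ₁,…,ℓ_m]` of series/parallel letters over a base environment `E`
(for the theta assembly `E` is the data of `B_y ∥ B_z` and `W` the word of the root's box read from the root outward).  `spine_facts`:
the five facts (nested root functional, its parallel transform, deleted / contracted / free-nested AND, all `≥ 0` against monotone nested
nonnegative weights) propagate from `E` to every `spine E W` (files 61a/61b are the two induction steps); `spine_root_nonneg`: hence the
root functional `M_{𝓔_W}(h) = M̃_{𝓔_W}(h ≤ h)` is nonnegative — the levelwise `q`-free `maj₃` inequality for the host `x ∥ 𝓔_W` once the base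
facts are discharged (THEOREM G27 = ♣ ≥ 0 for the pairs `(B_y,B_z)`, `(B_y,B_z∥g)`; AND⁺ on series–parallel graphs) and the root form is
bridged to `FK.apPsiCW` (memo §7 (L3), (L4)). [folklore]
-/

noncomputable section

namespace Summit.CriticalPhenomena.PercolationContinuityZ3.Theorems

namespace FK

namespace RootForm

open Finset

section Words

/-- Letters of a spine word: a series (`ser`) or a parallel (`par`) free edge. [folklore] -/
inductive Letter
  | ser
  | par

/-- Configurations of the spine environment `ℓ₁(ℓ₂(⋯ℓ_m(E)⋯))`: one Boolean (replica of the letter's edge) per letter, then a base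
configuration. [folklore] -/
def SpCfg (C : Type) : List Letter → Type
  | [] => C
  | _ :: W => Bool × SpCfg C W

/-- `SpCfg C W` is finite. [folklore] -/
instance instFintypeSpCfg (C : Type) [Fintype C] : (W : List Letter) → Fintype (SpCfg C W)
  | [] => inferInstanceAs (Fintype C)
  | _ :: W => haveI := instFintypeSpCfg C W; inferInstanceAs (Fintype (Bool × SpCfg C W))

/-- `SpCfg C W` carries the product (componentwise) preorder. [folklore] -/
instance instPreorderSpCfg (C : Type) [Preorder C] : (W : List Letter) → Preorder (SpCfg C W)
  | [] => inferInstanceAs (Preorder C)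
  | _ :: W => haveI := instPreorderSpCfg C W; inferInstanceAs (Preorder (Bool × SpCfg C W))

variable {C : Type} [Fintype C] [Preorder C]

/-- The spine environment of a word over a base environment (`W = [ℓ₁, …, ℓ_m]`, `ℓ₁` outermost, i.e. the letter of the root's box
nearest to the root). [folklore] -/
def spine (E : Env C) : (W : List Letter) → Env (SpCfg C W)
  | [] => E
  | Letter.ser :: W => serE (spine E W)
  | Letter.par :: W => parE (spine E W)

/-- **The word theorem (induction along a spine).**  If the base environment `E` satisfies the five facts — nested root functional
`M̃_E ≥ 0`, its parallel transform `M̃_{g∥E} ≥ 0`, and the deleted / contracted / free-nested AND functionals `≥ 0`, all against monotone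
(nested, nonnegative) weights — then so does every spine environment `ℓ₁(⋯ℓ_m(E)⋯)`.  For `E = B_y ∥ B_z` the first two facts are
THEOREM G27 (♣ ≥ 0, memo FROM-fk-2-g27 §4, for the pairs `(B_y, B_z)` and `(B_y, B_z ∥ g)`) and the last three are AND⁺ on
series–parallel graphs; the conclusion at `h₀ = h₁` is the black-box theta law ★(Θ) for every spine word (memo FROM-fk-2-g28 §4). [folklore] -/
theorem spine_facts (E : Env C)
    (hM : ∀ h0 h1 : C → ℝ, Monotone h0 → Monotone h1 → (∀ γ, 0 ≤ h0 γ) → (∀ γ, h0 γ ≤ h1 γ) → ∀ J : ℤ, 0 ≤ Mt E h0 h1 J)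
    (hP : ∀ h0 h1 : Bool × C → ℝ, Monotone h0 → Monotone h1 → (∀ p, 0 ≤ h0 p) → (∀ p, h0 p ≤ h1 p) → ∀ J : ℤ,
      0 ≤ Mt (parE E) h0 h1 J)
    (hd : ∀ h : C → ℝ, Monotone h → (∀ γ, 0 ≤ h γ) → ∀ J : ℤ, 0 ≤ ∑ γ, h γ * (E γ).andDel J)
    (hc : ∀ h : C → ℝ, Monotone h → (∀ γ, 0 ≤ h γ) → ∀ J : ℤ, 0 ≤ ∑ γ, h γ * (E γ).andCon J)
    (hf : ∀ h0 h1 : C → ℝ, Monotone h0 → Monotone h1 → (∀ γ, 0 ≤ h0 γ) → (∀ γ, h0 γ ≤ h1 γ) → ∀ J : ℤ,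
      0 ≤ ∑ γ, (h1 γ * (E γ).andE1 J + h0 γ * (E γ).andE2 J))
    (W : List Letter) :
    (∀ h0 h1 : SpCfg C W → ℝ, Monotone h0 → Monotone h1 → (∀ γ, 0 ≤ h0 γ) → (∀ γ, h0 γ ≤ h1 γ) → ∀ J : ℤ,
        0 ≤ Mt (spine E W) h0 h1 J)
    ∧ (∀ h0 h1 : Bool × SpCfg C W → ℝ, Monotone h0 → Monotone h1 → (∀ p, 0 ≤ h0 p) → (∀ p, h0 p ≤ h1 p) → ∀ J : ℤ,
        0 ≤ Mt (parE (spine E W)) h0 h1 J)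
    ∧ (∀ h : SpCfg C W → ℝ, Monotone h → (∀ γ, 0 ≤ h γ) → ∀ J : ℤ, 0 ≤ ∑ γ, h γ * (spine E W γ).andDel J)
    ∧ (∀ h : SpCfg C W → ℝ, Monotone h → (∀ γ, 0 ≤ h γ) → ∀ J : ℤ, 0 ≤ ∑ γ, h γ * (spine E W γ).andCon J)
    ∧ (∀ h0 h1 : SpCfg C W → ℝ, Monotone h0 → Monotone h1 → (∀ γ, 0 ≤ h0 γ) → (∀ γ, h0 γ ≤ h1 γ) → ∀ J : ℤ,
        0 ≤ ∑ γ, (h1 γ * (spine E W γ).andE1 J + h0 γ * (spine E W γ).andE2 J)) := by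
  induction W with
  | nil => exact ⟨hM, hP, hd, hc, hf⟩
  | cons l W ih =>
    obtain ⟨iM, iP, id, ic, iF⟩ := ih
    cases l with
    | ser =>
      refine ⟨?_, ?_, ?_, ?_, ?_⟩
      · exact fun h0 h1 m0 m1 n0 le J => Mt_ser_nonneg iM id m0 m1 n0 le J
      · exact fun h0 h1 m0 m1 n0 le J => Mt_par_ser_nonneg iM id iF m0 m1 n0 le J
      · exact fun h m n J => andDel_ser_nonneg id m n J
      · exact fun h m n J => andCon_ser_nonneg iF m n J
      · exact fun h0 h1 m0 m1 n0 le J => andFree_ser_nonneg iF id m0 m1 n0 le J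
    | par =>
      refine ⟨?_, ?_, ?_, ?_, ?_⟩
      · exact fun h0 h1 m0 m1 n0 le J => iP h0 h1 m0 m1 n0 le J
      · exact fun h0 h1 m0 m1 n0 le J => Mt_par_par_nonneg iP ic m0 m1 n0 le J
      · exact fun h m n J => andDel_par_nonneg iF m n J
      · exact fun h m n J => andCon_par_nonneg ic m n J
      · exact fun h0 h1 m0 m1 n0 le J => andFree_par_nonneg iF ic m0 m1 n0 le J

/-- **★(Θ) in root form for every spine word.**  Under the five base facts, the (un-nested) root functional of every spine
environment is nonnegative against every monotone nonnegative weight: `0 ≤ M_{𝓔_W}(h; J) = M̃_{𝓔_W}(h ≤ h; J)`. [folklore] -/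
theorem spine_root_nonneg (E : Env C)
    (hM : ∀ h0 h1 : C → ℝ, Monotone h0 → Monotone h1 → (∀ γ, 0 ≤ h0 γ) → (∀ γ, h0 γ ≤ h1 γ) → ∀ J : ℤ, 0 ≤ Mt E h0 h1 J)
    (hP : ∀ h0 h1 : Bool × C → ℝ, Monotone h0 → Monotone h1 → (∀ p, 0 ≤ h0 p) → (∀ p, h0 p ≤ h1 p) → ∀ J : ℤ,
      0 ≤ Mt (parE E) h0 h1 J)
    (hd : ∀ h : C → ℝ, Monotone h → (∀ γ, 0 ≤ h γ) → ∀ J : ℤ, 0 ≤ ∑ γ, h γ * (E γ).andDel J)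
    (hc : ∀ h : C → ℝ, Monotone h → (∀ γ, 0 ≤ h γ) → ∀ J : ℤ, 0 ≤ ∑ γ, h γ * (E γ).andCon J)
    (hf : ∀ h0 h1 : C → ℝ, Monotone h0 → Monotone h1 → (∀ γ, 0 ≤ h0 γ) → (∀ γ, h0 γ ≤ h1 γ) → ∀ J : ℤ,
      0 ≤ ∑ γ, (h1 γ * (E γ).andE1 J + h0 γ * (E γ).andE2 J))
    (W : List Letter) (h : SpCfg C W → ℝ) (hm : Monotone h) (hn : ∀ γ, 0 ≤ h γ) (J : ℤ) :
    0 ≤ Mt (spine E W) h h J :=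
  (spine_facts E hM hP hd hc hf W).1 h h hm hm hn (fun _ => le_rfl) J

end Words


end RootForm

end FK

end Summit.CriticalPhenomena.PercolationContinuityZ3.Theorems
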